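/-
Copyright (c) 2026. All rights reserved.
Released under Apache 2.0 license as described in the file LICENSE.
Authors: abc-iut cell, prover seat abc-iut-L4-d1 (gen 9; row «COMPACT-HYP⇒NONAB», F4a: the centraliser of a
hyperbolic element of `PSL₂(ℝ)`, the bounded axis function `exp ((2πi/ℓ) log τ)`, the discreteness of the
translation / dilation parameters of a properly discontinuous group, and «elliptic elements have fixed points»).
-/
import Literature.AnabelianGeometry.AbsoluteAnabelian.ArchimedeanHolFieldFunctorGeometricPSLCuspFunction
import HarnessLib

/-!
# The centraliser of a hyperbolic element of `PSL₂(ℝ)`, the bounded axis function, and discreteness of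
# one-parameter families in a properly discontinuous group (PROOF-ONLY)

Classical input for S. Mochizuki, *Topics in Absolute Anabelian Geometry III*, Cor. 2.4 p.54 / Prop. 4.2 (i)
p.106 («`X` a HYPERBOLIC Riemann surface of finite type», uniformised as `ℍ/Λ̄`): the step «a hyperbolic
surface of finite type — in particular a COMPACT one — has non-abelian `π₁`», after H. M. Farkas, I. Kra,
*Riemann Surfaces* (1992), IV.6 (an abelian torsion-free Fuchsian group is cyclic; `ℍ/Λ̄` is then `ℍ`, a
punctured disc or an annulus) and G. Shimura, *Introduction to the Arithmetic Theory of Automorphic Functions*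
(1971), §1.3 (centralisers in `SL₂(ℝ)`).  This file is the HYPERBOLIC twin of
`…PSLCuspFunction` (which treats the parabolic case) plus two generic bricks:

* §1 `HolRS.exists_diag_of_mul_diag_eq`, `HolRS.diag_mul_ne_neg_mul`, ★ `HolRS.exists_psl_mk_diag_of_commute`,
  `HolRS.exists_eq_conj_diag_of_commute` — an element of `PSL₂(ℝ)` commuting with `π(D)`, `D = diag(l, l⁻¹)`,
  `l² ≠ 1`, IS `π(E)` with `E` diagonal (the `2 × 2` identity `G D = ±D G` forces `G` diagonal);
* §2 ★ `HolRS.exists_axisFunction` — for `g ∈ SL(2, ℝ)` and `ℓ > 0` there is a HOLOMORPHIC `F : ℍ → ℂ` with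
  `‖F τ‖ < 1`, NOT constant, and `F (q • τ) = F τ` for every `q ∈ PSL₂(ℝ)` acting in the frame `g` as a
  dilation by `e^{nℓ}`, `n ∈ ℤ` (namely `F τ = exp ((2πi/ℓ) · log (g⁻¹ • τ))`, the coordinate of the annulus
  `ℍ/⟨τ ↦ e^{ℓ} τ⟩`);
* §3 ★ `HolRS.exists_eq_closure_of_smul_curve` — if a group `Λ` acts properly discontinuously on `ℍ` and
  every `y` in an additive subgroup `Y ≤ ℝ` is realised by some `q ∈ Λ` moving `c 0` to `c y` along an
  injective continuous curve `c : ℝ → ℍ`, then `Y` is CYCLIC (`Y` is isolated at `0` by proper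
  discontinuity; Mathlib `AddSubgroup.cyclic_of_isolated_zero`);
* §4 `HolRS.psl_mk_eq_one_of_isElliptic_of_mem` — an elliptic element has a fixed point in `ℍ` (Mathlib
  `UpperHalfPlane.fixedPt`), so it cannot lie in a subgroup of `PSL₂(ℝ)` acting FREELY (`IsCancelSMul`);
  `HolRS.isParabolic_of_sq_trace_eq_four` — a non-trivial element of `PSL₂(ℝ)` with `(tr)² = 4` is
  parabolic (`Matrix.IsParabolic`); `HolRS.discr_coe_sl` — the discriminant of `G ∈ SL(2, ℝ)` is `(tr G)² − 4`.

(Also: `HolRS.coe_conj_diag_smul` — `π(g E g⁻¹)` acts in the frame `g` as the dilation by `E₀₀² > 0`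
(`HolRS.diag_sq_pos`).)

Consumed by `…PSLAbelianDeckInvariant` (an abelian torsion-free Fuchsian group admits a bounded invariant
non-constant holomorphic function) and `…PSLCompactGenuineHyperbolic` (a COMPACT Riemann surface uniformised by
`ℍ` has non-abelian `π₁`).  PROOF-ONLY (no definition, no instance, no named fact); classical; MODEL side of
[AbsTopIII] §2/§4; nothing here bears on the disputed [IUTchIII] Cor. 3.12.

## References
* G. Shimura, *Introduction to the Arithmetic Theory of Automorphic Functions* (1971), §1.3. [Shimura1971]
* H. M. Farkas, I. Kra, *Riemann Surfaces*, 2nd ed. (1992), IV.5.6, IV.6. [FarkasKra1992]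
* A. F. Beardon, *The Geometry of Discrete Groups*, GTM 91 (1983), §4.3, Thm 5.4.1. [Beardon1983]
* S. Mochizuki, *Topics in Absolute Anabelian Geometry III* (2015), Cor. 2.4 p.54, Prop. 4.2 (i) p.106.
  [MochizukiAbsTopIII2015]
-/

set_option autoImplicit false

noncomputable section

open Complex Filter Topology Set Function
open scoped UpperHalfPlane MatrixGroups Matrix Manifold ContDiff Real
open Literature.NumberTheory.Automorphic.Fuchsian (translSL coe_diag_smul diag_mul_eq_one diag_ne_of_sq_ne_one)

namespace Literature.AnabelianGeometry.AbsoluteAnabelian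

namespace HolRS

/-! ### §1 The centraliser of a diagonal element in `SL(2, ℝ)` and `PSL₂(ℝ)` -/

/-- Entries of `G D` and `D G` for a diagonal `D`. [folklore] -/
private theorem mul_diag_entries (G : SL(2, ℝ)) {D : SL(2, ℝ)} (h01 : D 0 1 = 0) (h10 : D 1 0 = 0) :
    (G * D) 0 0 = G 0 0 * D 0 0 ∧ (G * D) 0 1 = G 0 1 * D 1 1 ∧ (G * D) 1 0 = G 1 0 * D 0 0 ∧
      (G * D) 1 1 = G 1 1 * D 1 1 ∧ (D * G) 0 0 = D 0 0 * G 0 0 ∧ (D * G) 0 1 = D 0 0 * G 0 1 ∧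
        (D * G) 1 0 = D 1 1 * G 1 0 ∧ (D * G) 1 1 = D 1 1 * G 1 1 := by
  simp only [Matrix.SpecialLinearGroup.coe_mul, Matrix.mul_apply, Fin.sum_univ_two, h01, h10]
  refine ⟨by ring, by ring, by ring, by ring, by ring, by ring, by ring, by ring⟩

/-- **An element of `SL(2, ℝ)` commuting with a diagonal `D = diag(l, l⁻¹)`, `l² ≠ 1`, is diagonal**:
`G D = D G` forces `b (l⁻¹ − l) = 0 = c (l − l⁻¹)`. [cite: Shimura1971, §1.3] -/
theorem exists_diag_of_mul_diag_eq {G D : SL(2, ℝ)} (h01 : D 0 1 = 0) (h10 : D 1 0 = 0)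
    (hl : D 0 0 ^ 2 ≠ 1) (hc : G * D = D * G) : G 0 1 = 0 ∧ G 1 0 = 0 := by
  obtain ⟨-, e01, e10, -, -, f01, f10, -⟩ := mul_diag_entries G h01 h10
  have hne : D 0 0 ≠ D 1 1 := diag_ne_of_sq_ne_one h01 hl
  have k01 : (G * D) 0 1 = (D * G) 0 1 := by rw [hc]
  have k10 : (G * D) 1 0 = (D * G) 1 0 := by rw [hc]
  rw [e01, f01] at k01
  rw [e10, f10] at k10
  constructor
  · have : G 0 1 * (D 1 1 - D 0 0) = 0 := by linarith
    exact (mul_eq_zero.mp this).resolve_right (sub_ne_zero.mpr hne.symm)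
  · have : G 1 0 * (D 0 0 - D 1 1) = 0 := by linarith
    exact (mul_eq_zero.mp this).resolve_right (sub_ne_zero.mpr hne)

/-- `D G = -(G D)` is impossible in `SL(2, ℝ)` for a diagonal `D` (it forces `a = d = 0` and, as
`l + l⁻¹ ≠ 0`, `b = 0`, so `det G = 0`). [cite: Shimura1971, §1.3] -/
theorem diag_mul_ne_neg_mul (G : SL(2, ℝ)) {D : SL(2, ℝ)} (h01 : D 0 1 = 0) (h10 : D 1 0 = 0) :
    D * G ≠ -(G * D) := by
  intro hc
  obtain ⟨e00, e01, -, -, f00, f01, -, -⟩ := mul_diag_entries G h01 h10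
  have hd := diag_mul_eq_one h01
  have k00 : (D * G) 0 0 = -((G * D) 0 0) := by rw [hc, Matrix.SpecialLinearGroup.coe_neg]; rfl
  have k01 : (D * G) 0 1 = -((G * D) 0 1) := by rw [hc, Matrix.SpecialLinearGroup.coe_neg]; rfl
  rw [f00, e00] at k00
  rw [f01, e01] at k01
  have hD0 : D 0 0 ≠ 0 := fun h => by rw [h, zero_mul] at hd; exact zero_ne_one hd
  have ha : G 0 0 = 0 := by
    have : G 0 0 * (2 * D 0 0) = 0 := by linarith
    exact (mul_eq_zero.mp this).resolve_right (mul_ne_zero two_ne_zero hD0)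
  have hsum : D 0 0 + D 1 1 ≠ 0 := by
    intro h
    have h' : D 1 1 = -D 0 0 := by linarith
    rw [h'] at hd
    nlinarith [sq_nonneg (D 0 0)]
  have hb : G 0 1 = 0 := by
    have : G 0 1 * (D 0 0 + D 1 1) = 0 := by linarith
    exact (mul_eq_zero.mp this).resolve_right hsum
  have hdet : G 0 0 * G 1 1 - G 0 1 * G 1 0 = 1 := by
    have := G.det_coe
    rwa [Matrix.det_fin_two] at this
  rw [ha, hb] at hdet
  norm_num at hdet

/-- ★ **The centraliser of a hyperbolic element of `PSL₂(ℝ)` in diagonal form**: if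
`q · π(D) = π(D) · q` with `D = diag(l, l⁻¹)`, `l² ≠ 1`, then `q = π(E)` for a DIAGONAL `E ∈ SL(2, ℝ)`.
(Lift `q = π(E)`: then `D E = ±E D` in `SL(2, ℝ)`; the sign `-` is impossible, the sign `+` makes `E`
diagonal.) [cite: Shimura1971, §1.3] [cite: FarkasKra1992, IV.6] -/
theorem exists_psl_mk_diag_of_commute {q : PSL2R} {D : SL(2, ℝ)} (h01 : D 0 1 = 0) (h10 : D 1 0 = 0)
    (hl : D 0 0 ^ 2 ≠ 1)
    (hc : q * QuotientGroup.mk' (Subgroup.center SL(2, ℝ)) D = QuotientGroup.mk' (Subgroup.center SL(2, ℝ)) D * q) :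
    ∃ E : SL(2, ℝ), E 0 1 = 0 ∧ E 1 0 = 0 ∧ q = QuotientGroup.mk' (Subgroup.center SL(2, ℝ)) E := by
  obtain ⟨E, rfl⟩ := QuotientGroup.mk'_surjective (Subgroup.center SL(2, ℝ)) q
  rw [← map_mul, ← map_mul, QuotientGroup.mk'_apply, QuotientGroup.mk'_apply, QuotientGroup.eq] at hc
  rcases mem_center_sl_iff.mp hc with h1 | h1
  · have hc' : E * D = D * E := by
      rw [inv_mul_eq_one] at h1
      exact h1
    obtain ⟨hE01, hE10⟩ := exists_diag_of_mul_diag_eq h01 h10 hl hc'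
    exact ⟨E, hE01, hE10, rfl⟩
  · exfalso
    apply diag_mul_ne_neg_mul E h01 h10
    rw [inv_mul_eq_iff_eq_mul, mul_neg_one] at h1
    exact h1

/-- **The same in the frame `g`**: if `q` commutes with `π(g D g⁻¹)`, `D = diag(l, l⁻¹)`, `l² ≠ 1`, then
`q = π(g E g⁻¹)` for a diagonal `E ∈ SL(2, ℝ)`. [cite: Shimura1971, §1.3] [cite: FarkasKra1992, IV.6] -/
theorem exists_eq_conj_diag_of_commute {q : PSL2R} {g D : SL(2, ℝ)} (h01 : D 0 1 = 0) (h10 : D 1 0 = 0)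
    (hl : D 0 0 ^ 2 ≠ 1)
    (hc : q * QuotientGroup.mk' (Subgroup.center SL(2, ℝ)) (g * D * g⁻¹) =
      QuotientGroup.mk' (Subgroup.center SL(2, ℝ)) (g * D * g⁻¹) * q) :
    ∃ E : SL(2, ℝ), E 0 1 = 0 ∧ E 1 0 = 0 ∧
      q = QuotientGroup.mk' (Subgroup.center SL(2, ℝ)) (g * E * g⁻¹) := by
  set a : PSL2R := QuotientGroup.mk' (Subgroup.center SL(2, ℝ)) g with ha
  set d : PSL2R := QuotientGroup.mk' (Subgroup.center SL(2, ℝ)) D with hd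
  rw [map_mul, map_mul, map_inv] at hc
  have hc' : (a⁻¹ * q * a) * d = d * (a⁻¹ * q * a) := by
    calc a⁻¹ * q * a * d = a⁻¹ * (q * (a * d * a⁻¹)) * a := by group
      _ = a⁻¹ * ((a * d * a⁻¹) * q) * a := by rw [hc]
      _ = d * (a⁻¹ * q * a) := by group
  obtain ⟨E, hE01, hE10, hE⟩ := exists_psl_mk_diag_of_commute h01 h10 hl hc'
  refine ⟨E, hE01, hE10, ?_⟩
  rw [map_mul, map_mul, map_inv, ← ha, ← hE]
  group

/-- A diagonal element of `SL(2, ℝ)` acts in the frame `g` as the dilation by `l² > 0`: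
`g⁻¹ • (π(g E g⁻¹) • (g • τ)) = l² τ`. [cite: FarkasKra1992, IV.6] -/
theorem coe_conj_diag_smul {g E : SL(2, ℝ)} (hE01 : E 0 1 = 0) (hE10 : E 1 0 = 0) (τ : ℍ) :
    ((g⁻¹ • ((QuotientGroup.mk' (Subgroup.center SL(2, ℝ)) (g * E * g⁻¹) : PSL2R) • (g • τ)) : ℍ) : ℂ) =
      ((E 0 0 ^ 2 : ℝ) : ℂ) * (τ : ℂ) := by
  rw [QuotientGroup.mk'_apply, psl_mk_smul, ← mul_smul, ← mul_smul, ← coe_diag_smul hE01 hE10 τ]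
  congr 2
  group

/-- The dilation factor `l²` of a diagonal `diag(l, l⁻¹) ∈ SL(2, ℝ)` (acting by `z ↦ l² z`) is positive.
[cite: Beardon1983, §4.3] -/
theorem diag_sq_pos {E : SL(2, ℝ)} (hE01 : E 0 1 = 0) : 0 < E 0 0 ^ 2 := by
  have hd := diag_mul_eq_one hE01
  have : E 0 0 ≠ 0 := fun h => by rw [h, zero_mul] at hd; exact zero_ne_one hd
  positivity

/-! ### §2 The bounded axis function -/

/-- ★ **The bounded axis function.**  For `g ∈ SL(2, ℝ)` and `ℓ > 0`, the function
`F τ = exp ((2πi/ℓ) · log (g⁻¹ • τ))` on `ℍ` (principal logarithm; `g⁻¹ • τ ∈ ℍ` avoids the cut) is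
holomorphic, satisfies `‖F τ‖ = e^{−2π arg(g⁻¹ • τ)/ℓ} < 1`, is invariant under every `q ∈ PSL₂(ℝ)` acting in
the frame `g` as a dilation by `e^{nℓ}`, `n ∈ ℤ` — `g⁻¹ • (q • (g • τ)) = e^{nℓ} τ` — and is not constant.
(It is the coordinate of the annulus quotient of `ℍ` by the hyperbolic cyclic group with axis `g • iℝ₊`.)
[cite: FarkasKra1992, IV.6] [cite: MochizukiAbsTopIII2015, Definition 4.1 (i) p.101] -/
theorem exists_axisFunction (g : SL(2, ℝ)) {ℓ : ℝ} (hℓ : 0 < ℓ) :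
    ∃ F : ℍ → ℂ, MDifferentiable 𝓘(ℂ, ℂ) 𝓘(ℂ, ℂ) F ∧ (∀ τ, ‖F τ‖ < 1) ∧
      (∀ (q : PSL2R) (n : ℤ), (∀ τ : ℍ, (((g⁻¹ • (q • (g • τ))) : ℍ) : ℂ) = Real.exp (n * ℓ) * (τ : ℂ)) →
        ∀ τ : ℍ, F (q • τ) = F τ) ∧ ∃ τ₁ τ₂, F τ₁ ≠ F τ₂ := by
  -- the constant `c = 2π/ℓ > 0` and the function
  set c : ℝ := 2 * π / ℓ with hc
  have hc0 : 0 < c := div_pos Real.two_pi_pos hℓ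
  have hcl : (c : ℂ) * (ℓ : ℂ) = 2 * π := by
    rw [← ofReal_mul, hc, div_mul_cancel₀ _ hℓ.ne']
    push_cast
    ring
  -- `‖exp (c i log σ)‖ = e^{-c arg σ}` and `0 < arg σ < π` on `ℍ`
  have hnorm : ∀ w : ℂ, ‖exp ((c : ℂ) * I * log w)‖ = Real.exp (-(c * arg w)) := fun w => by
    rw [norm_exp, show (c : ℂ) * I * log w = c * (log w * I) by ring, re_ofReal_mul, mul_I_re, log_im,
      mul_neg]
  have harg : ∀ σ : ℍ, 0 < arg (σ : ℂ) := fun σ => by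
    rcases (arg_nonneg_iff.mpr σ.im_pos.le).lt_or_eq with h | h
    · exact h
    · exact absurd (arg_eq_zero_iff.mp h.symm).2 σ.im_ne_zero
  refine ⟨fun τ => exp ((c : ℂ) * I * log ((g⁻¹ • τ : ℍ) : ℂ)), ?_, ?_, ?_, ?_⟩
  · -- holomorphic: Möbius map, the inclusion `ℍ → ℂ`, then `w ↦ exp (c i log w)` off the cut `(-∞, 0]`
    have h1 : MDifferentiable 𝓘(ℂ, ℂ) 𝓘(ℂ, ℂ) (fun τ : ℍ => ((g⁻¹ • τ : ℍ) : ℂ)) :=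
      UpperHalfPlane.mdifferentiable_coe.comp ((contMDiff_sl_smul g⁻¹).mdifferentiable (by simp))
    intro τ
    have h2 : DifferentiableAt ℂ (fun w : ℂ => exp ((c : ℂ) * I * log w)) ((g⁻¹ • τ : ℍ) : ℂ) :=
      ((differentiableAt_const _).mul (differentiableAt_id.clog (Or.inr (g⁻¹ • τ).im_ne_zero))).cexp
    show MDifferentiableAt 𝓘(ℂ, ℂ) 𝓘(ℂ, ℂ)
      ((fun w : ℂ => exp ((c : ℂ) * I * log w)) ∘ fun τ : ℍ => ((g⁻¹ • τ : ℍ) : ℂ)) τ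
    exact (mdifferentiableAt_iff_differentiableAt.mpr h2).comp τ (h1 τ)
  · -- `‖F τ‖ = exp (-c · arg (g⁻¹ • τ)) < 1`
    intro τ
    show ‖exp ((c : ℂ) * I * log ((g⁻¹ • τ : ℍ) : ℂ))‖ < 1
    rw [hnorm, Real.exp_lt_one_iff, neg_lt_zero]
    exact mul_pos hc0 (harg _)
  · -- invariance: `log (e^{nℓ} w) = nℓ + log w` and `exp (2πi n) = 1`
    intro q n hq τ
    have hsm : (g⁻¹ • (q • τ) : ℍ) = g⁻¹ • (q • (g • (g⁻¹ • τ))) := by rw [smul_inv_smul]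
    show exp ((c : ℂ) * I * log ((g⁻¹ • (q • τ) : ℍ) : ℂ)) = exp ((c : ℂ) * I * log ((g⁻¹ • τ : ℍ) : ℂ))
    rw [hsm, hq (g⁻¹ • τ), log_ofReal_mul (Real.exp_pos _) (g⁻¹ • τ).ne_zero, Real.log_exp, mul_add,
      exp_add]
    have : (c : ℂ) * I * ((n * ℓ : ℝ) : ℂ) = n * (2 * π * I) := by
      push_cast
      linear_combination (I * n) * hcl
    rw [this, exp_int_mul_two_pi_mul_I, one_mul]
  · -- not constant: at `g • i` and `g • e^{iπ/4}` the moduli `e^{-cπ/2} ≠ e^{-cπ/4}` differ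
    have hθ : (π / 4 : ℝ) ∈ Set.Ioc (-π) π := ⟨by linarith [Real.pi_pos], by linarith [Real.pi_pos]⟩
    refine ⟨g • UpperHalfPlane.mk I (by simp),
      g • UpperHalfPlane.mk (Real.cos (π / 4) + Real.sin (π / 4) * I) (by simp), fun heq => ?_⟩
    have h := congrArg (fun z : ℂ => ‖z‖) heq
    simp only [inv_smul_smul, UpperHalfPlane.coe_mk] at h
    rw [hnorm, hnorm, arg_I, ofReal_cos, ofReal_sin, arg_cos_add_sin_mul_I hθ] at h
    have := Real.exp_injective h
    have : c * (π / 2) = c * (π / 4) := by linarith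
    have := mul_left_cancel₀ hc0.ne' this
    linarith [Real.pi_pos]

/-! ### §3 One-parameter families in a properly discontinuous group are discrete -/

/-- ★ **Discreteness of the parameters.**  Let `Λ` act properly discontinuously on `ℍ`, let
`c : ℝ → ℍ` be an injective continuous curve and `Y ≤ ℝ` an additive subgroup such that every `y ∈ Y`
is realised by some `q ∈ Λ` with `q • c 0 = c y` (e.g. the translation lengths at a cusp, or the
logarithmic dilation factors along an axis, of the elements of `Λ`).  Then `Y` is CYCLIC: only finitely
many `q ∈ Λ` move the compact arc `c [0, 1]` to meet itself, so `Y ∩ (0, 1)` is finite, `Y` is isolated at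
`0`, and an additive subgroup of `ℝ` isolated at `0` is cyclic. [cite: Beardon1983, §4.3]
[cite: FarkasKra1992, IV.6] -/
theorem exists_eq_closure_of_smul_curve {Λ : Type*} [SMul Λ ℍ] [ProperlyDiscontinuousSMul Λ ℍ]
    (Y : AddSubgroup ℝ) (c : ℝ → ℍ) (hcont : Continuous c) (hinj : Injective c)
    (hY : ∀ y ∈ Y, ∃ q : Λ, q • c 0 = c y) : ∃ b : ℝ, Y = AddSubgroup.closure {b} := by
  classical
  have hK : IsCompact (c '' Icc 0 1) := isCompact_Icc.image hcont
  have hfin : Set.Finite {γ : Λ | ((γ • ·) '' (c '' Icc (0 : ℝ) 1) ∩ c '' Icc (0 : ℝ) 1).Nonempty} :=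
    ProperlyDiscontinuousSMul.finite_disjoint_inter_image hK hK
  obtain ⟨q₀, -⟩ := hY 0 Y.zero_mem
  haveI : Nonempty Λ := ⟨q₀⟩
  choose! q hq using hY
  have hmaps : MapsTo q ((Y : Set ℝ) ∩ Ioo 0 1)
      {γ : Λ | ((γ • ·) '' (c '' Icc (0 : ℝ) 1) ∩ c '' Icc (0 : ℝ) 1).Nonempty} := by
    rintro y ⟨hyY, hy0, hy1⟩
    exact ⟨c y, ⟨c 0, ⟨0, ⟨le_rfl, zero_le_one⟩, rfl⟩, hq y hyY⟩, ⟨y, ⟨hy0.le, hy1.le⟩, rfl⟩⟩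
  have hinjOn : InjOn q ((Y : Set ℝ) ∩ Ioo 0 1) := by
    rintro y ⟨hyY, -⟩ y' ⟨hy'Y, -⟩ h
    apply hinj
    rw [← hq y hyY, ← hq y' hy'Y, h]
  have hfin' : ((Y : Set ℝ) ∩ Ioo 0 1).Finite :=
    Set.Finite.of_finite_image (hfin.subset hmaps.image_subset) hinjOn
  -- `Y` is isolated at `0`
  obtain ⟨ε, hε, hdisj⟩ : ∃ ε : ℝ, 0 < ε ∧ Disjoint (Y : Set ℝ) (Ioo 0 ε) := by
    rcases ((Y : Set ℝ) ∩ Ioo 0 1).eq_empty_or_nonempty with h | h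
    · exact ⟨1, one_pos, Set.disjoint_iff_inter_eq_empty.mpr h⟩
    · obtain ⟨m, ⟨hmY, hm0, hm1⟩, hmin⟩ := Set.exists_min_image _ id hfin' h
      refine ⟨m, hm0, Set.disjoint_left.mpr fun y hyY hy => ?_⟩
      have := hmin y ⟨hyY, hy.1, hy.2.trans hm1⟩
      exact absurd hy.2 (not_lt.mpr this)
  exact AddSubgroup.cyclic_of_isolated_zero hε hdisj

/-! ### §4 Elliptic and parabolic elements -/

/-- **An elliptic element cannot lie in a subgroup of `PSL₂(ℝ)` acting freely on `ℍ`**: an elliptic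
`G ∈ SL(2, ℝ)` (`(tr G)² < 4`) fixes a point of `ℍ` (Mathlib `UpperHalfPlane.fixedPt`), so if
`π(G) ∈ Λ̄` with `Λ̄` acting freely (`IsCancelSMul`), then `π(G) = 1`.  (Deck transformations have no fixed
points: a torsion-free Fuchsian group has no elliptic elements.) [cite: FarkasKra1992, IV.6]
[cite: Beardon1983, §4.3] -/
theorem psl_mk_eq_one_of_isElliptic_of_mem (Λ : Subgroup PSL2R) [IsCancelSMul Λ ℍ] {G : SL(2, ℝ)}
    (hG : (G : Matrix (Fin 2) (Fin 2) ℝ).IsElliptic)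
    (hΛ : (QuotientGroup.mk' (Subgroup.center SL(2, ℝ)) G : PSL2R) ∈ Λ) :
    (QuotientGroup.mk' (Subgroup.center SL(2, ℝ)) G : PSL2R) = 1 := by
  set g : GL (Fin 2) ℝ := Matrix.SpecialLinearGroup.toGL G with hg
  have hpos : 0 < g.val.det := by
    rw [hg, Matrix.SpecialLinearGroup.coe_GL_coe_matrix, Matrix.SpecialLinearGroup.det_coe]
    exact one_pos
  have hell : g.IsElliptic := hG
  set z : ℍ := UpperHalfPlane.fixedPt g hell with hz
  have hfix : g • z = z := (UpperHalfPlane.gl_smul_eq_self_iff_eq_fixedPt hpos hell).mpr rfl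
  have hfix' : (⟨_, hΛ⟩ : Λ) • z = (1 : Λ) • z := by
    rw [one_smul]
    exact hfix
  have := IsCancelSMul.right_cancel _ _ _ hfix'
  exact congrArg Subtype.val this

/-- **A non-trivial element of `PSL₂(ℝ)` with `(tr)² = 4` is parabolic** (it is not `±1`, hence not scalar,
and its discriminant `(tr)² − 4` vanishes). [cite: Shimura1971, §1.3] -/
theorem isParabolic_of_sq_trace_eq_four {G : SL(2, ℝ)} (htr : (G 0 0 + G 1 1) ^ 2 = 4)
    (h1 : (QuotientGroup.mk' (Subgroup.center SL(2, ℝ)) G : PSL2R) ≠ 1) :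
    (G : Matrix (Fin 2) (Fin 2) ℝ).IsParabolic := by
  refine ⟨?_, ?_⟩
  · rintro ⟨a, ha⟩
    apply h1
    rw [QuotientGroup.mk'_apply, ← QuotientGroup.mk_one, QuotientGroup.eq, mul_one]
    refine (Subgroup.center SL(2, ℝ)).inv_mem (mem_center_sl_iff.mpr ?_)
    have e : ∀ i j, (G : Matrix (Fin 2) (Fin 2) ℝ) i j = (Matrix.scalar (Fin 2) a) i j := fun i j => by
      rw [ha]
    have e00 : G 0 0 = a := by simpa using e 0 0
    have e01 : G 0 1 = 0 := by simpa using e 0 1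
    have e10 : G 1 0 = 0 := by simpa using e 1 0
    have e11 : G 1 1 = a := by simpa using e 1 1
    have hdet : a * a = 1 := by
      have h := G.det_coe
      rw [Matrix.det_fin_two, e00, e01, e10, e11] at h
      linarith
    rcases mul_self_eq_one_iff.mp hdet with rfl | rfl
    · left
      ext i j
      fin_cases i <;> fin_cases j <;> simp [e00, e01, e10, e11]
    · right
      ext i j
      fin_cases i <;> fin_cases j <;> simp [e00, e01, e10, e11, Matrix.SpecialLinearGroup.coe_neg]
  · rw [Matrix.discr_fin_two, Matrix.trace_fin_two, Matrix.SpecialLinearGroup.det_coe]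
    linarith

/-- The discriminant of `G ∈ SL(2, ℝ)` is `(tr G)² − 4` (the quantity classifying `G` as elliptic / parabolic /
hyperbolic). [cite: Shimura1971, §1.3] -/
theorem discr_coe_sl (G : SL(2, ℝ)) : (G : Matrix (Fin 2) (Fin 2) ℝ).discr = (G 0 0 + G 1 1) ^ 2 - 4 := by
  rw [Matrix.discr_fin_two, Matrix.trace_fin_two, Matrix.SpecialLinearGroup.det_coe]
  ring

end HolRS

end Literature.AnabelianGeometry.AbsoluteAnabelian

end
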